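import Summits.Parity.BatemanHorn.Theses.SelbergDelangeRigidity
import Summits.Parity.BatemanHorn.Theorems.SystemLSDRealSegment.Negative.OmegaWide
import Summits.Parity.BatemanHorn.Theorems.LSDRealSegment.Negative.OddDivisorSum

/-!
# `LSDRealSegment` — SHARP wall: the Ω-law fails AT `y = 2` for `f = X`

A refuted natural strengthening of the crux `Summit.Parity.BatemanHorn.Theses.SelbergDelangeRigidity.LSDRealSegment`
(stmt-Parity-9770), from the standing disprover's work file `Cruxes/LSDRealSegment/Disproof.lean` §5b: already the
CLOSED segment `5/4 < y ≤ 2` fails, at `y = 2` itself, for the Bateman–Horn system `f = X`: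
`x⁻¹ (log x)^{-1} Σ_{n ≤ x} 2^{Ω(n)} → +∞` (`tendsto_omegaNormSum_X_two_atTop`; truth `≍ log x`, Grosswald 1956),
hence `not_lsdRealSegment_upto_two`. Elementary proof: `2^{Ω(2^j m)} = 2^j 2^{Ω(m)} ≥ 2^j d(m)`, the dyadic pieces
`{2^j m : m odd}` are disjoint (`sum_Icc_ge_sum_dyadic`), and `Σ_{m ≤ M odd} d(m) ≥ (M/4) log M - 2M`
(`OddDivisorSum.lean`), whence `Σ_{n ≤ x} 2^{Ω(n)} ≥ (J+1)·x·((log x)/16 - 2)` as soon as `2^{J+1} ≤ √x`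
(`sum_two_pow_cardFactors_ge`) — a second logarithm that the normaliser `(log x)^{-1}` cannot absorb. Together with
`WallAtTwo.lean` (every `b > 2`): the real-segment law for the un-capped `Ω` lives EXACTLY on `y < 2`, and any proof of
the crux must use `y < 2` in an essential way (the pole of the `p = 2` Euler factor `Σ_v (y/2)^v`).
-/

open Filter Polynomial Finset
open scoped Topology

namespace Summit.Parity.BatemanHorn.Theorems.LSDRealSegment.Negative

open Literature.NumberTheory.Sieve
open Summit.Parity.BatemanHorn.Theorems.SystemLSDRealSegment.Negative
open ArithmeticFunction (cardFactors)

/-! ### Step 4: dyadic decomposition `Σ_{n ≤ x} 2^{Ω(n)} ≥ Σ_{j ≤ J} 2^j Σ_{m ≤ x/2^j odd} 2^{Ω(m)}` -/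

/-- `v_2(2^j m) = j` for odd `m`. [folklore] -/
theorem padicValNat_two_pow_mul_odd (j : ℕ) {m : ℕ} (hm : Odd m) : padicValNat 2 (2 ^ j * m) = j := by
  have hm0 : m ≠ 0 := fun h => by simp [h] at hm
  rw [padicValNat.mul (pow_ne_zero _ two_ne_zero) hm0, padicValNat.prime_pow,
    padicValNat.eq_zero_of_not_dvd (fun h2 => (Nat.not_even_iff_odd.2 hm) (even_iff_two_dvd.2 h2)), add_zero]

/-- The dyadic pieces `{2^j m : m ≤ x/2^j odd}`, `j = 0..J`, are disjoint subsets of `[1, x]`, so for a non-negative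
`g`: `Σ_{n ∈ [1,x]} g(n) ≥ Σ_{j ≤ J} Σ_{m ≤ x/2^j odd} g(2^j m)`. [folklore] -/
theorem sum_Icc_ge_sum_dyadic (g : ℕ → ℝ) (hg : ∀ n, 0 ≤ g n) (x J : ℕ) :
    ∑ j ∈ Finset.range (J + 1), ∑ m ∈ (Icc 1 (x / 2 ^ j)).filter Odd, g (2 ^ j * m) ≤
      ∑ n ∈ Icc 1 x, g n := by
  classical
  set T : Finset (Σ _ : ℕ, ℕ) := (Finset.range (J + 1)).sigma fun j => (Icc 1 (x / 2 ^ j)).filter Odd with hT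
  set φ : (Σ _ : ℕ, ℕ) → ℕ := fun t => 2 ^ t.1 * t.2 with hφ
  have hinj : Set.InjOn φ T := by
    rintro ⟨j, m⟩ hjm ⟨j', m'⟩ hjm' h
    simp only [hT, Finset.coe_sigma, Set.mem_sigma_iff, Finset.coe_range, Set.mem_Iio, Finset.coe_filter,
      Finset.mem_Icc, Set.mem_setOf_eq] at hjm hjm'
    simp only [hφ] at h
    have hj : j = j' := by
      have := congrArg (padicValNat 2) h
      rwa [padicValNat_two_pow_mul_odd j hjm.2.2, padicValNat_two_pow_mul_odd j' hjm'.2.2] at this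
    subst hj
    have hm : m = m' := Nat.eq_of_mul_eq_mul_left (pow_pos two_pos j) h
    subst hm
    rfl
  have hmaps : ∀ t ∈ T, φ t ∈ Icc 1 x := by
    rintro ⟨j, m⟩ hjm
    simp only [hT, Finset.mem_sigma, Finset.mem_range, Finset.mem_filter, Finset.mem_Icc] at hjm
    obtain ⟨-, ⟨hm1, hmx⟩, -⟩ := hjm
    simp only [hφ, Finset.mem_Icc]
    refine ⟨Nat.mul_pos (pow_pos two_pos j) hm1, ?_⟩
    calc 2 ^ j * m ≤ 2 ^ j * (x / 2 ^ j) := Nat.mul_le_mul_left _ hmx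
      _ ≤ x := Nat.mul_div_le x (2 ^ j)
  calc ∑ j ∈ Finset.range (J + 1), ∑ m ∈ (Icc 1 (x / 2 ^ j)).filter Odd, g (2 ^ j * m)
      = ∑ t ∈ T, g (φ t) := by rw [hT, Finset.sum_sigma]
    _ = ∑ n ∈ T.image φ, g n := (Finset.sum_image hinj).symm
    _ ≤ ∑ n ∈ Icc 1 x, g n := by
        refine Finset.sum_le_sum_of_subset_of_nonneg (fun n hn => ?_) fun _ _ _ => hg _
        obtain ⟨t, ht, rfl⟩ := Finset.mem_image.1 hn
        exact hmaps t ht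

/-! ### Step 5: `Σ_{n ≤ x} 2^{Ω(n)} ≥ (J+1) · x · ((log x)/16 - 2)` whenever `2^{J+1} ≤ √x` -/

/-- One dyadic piece: `2^j Σ_{m ≤ x/2^j odd} 2^{Ω(m)} ≥ x (log x)/16 - 2x` when `(j+1) log 2 ≤ (log x)/2`.
[folklore] -/
theorem dyadic_piece_ge {x j : ℕ} (hx : 3 ≤ x) (hj : ((j : ℝ) + 1) * Real.log 2 ≤ Real.log x / 2) :
    (x : ℝ) * Real.log x / 16 - 2 * x ≤
      ∑ m ∈ (Icc 1 (x / 2 ^ j)).filter Odd, (2 : ℝ) ^ cardFactors (2 ^ j * m) := by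
  set M := x / 2 ^ j with hM
  have hx0 : (0 : ℝ) < x := by exact_mod_cast (show 0 < x by omega)
  have hlogx : 1 < Real.log x := by
    rw [Real.lt_log_iff_exp_lt hx0]
    have := Real.exp_one_lt_d9
    have h3 : (3 : ℝ) ≤ x := by exact_mod_cast hx
    linarith
  -- `2^(j+1) ≤ x` (as reals and naturals)
  have hpow : (2 : ℝ) ^ (j + 1) ≤ x := by
    have h1 : (2 : ℝ) ^ (j + 1) = Real.exp (((j : ℝ) + 1) * Real.log 2) := by
      rw [← Real.rpow_natCast, Real.rpow_def_of_pos two_pos]; push_cast; ring_nf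
    rw [h1]
    calc Real.exp (((j : ℝ) + 1) * Real.log 2) ≤ Real.exp (Real.log x / 2) := Real.exp_le_exp.2 hj
      _ ≤ Real.exp (Real.log x) := Real.exp_le_exp.2 (by linarith)
      _ = x := Real.exp_log hx0
  have hpow_nat : 2 ^ (j + 1) ≤ x := by exact_mod_cast hpow
  -- `2^j M ≥ x/2`
  have h2jM : (x : ℝ) / 2 ≤ (2 : ℝ) ^ j * M := by
    have h := Nat.lt_div_mul_add (a := x) (b := 2 ^ j) (pow_pos two_pos j)
    have h' : (x : ℝ) < (M : ℝ) * (2 : ℝ) ^ j + (2 : ℝ) ^ j := by rw [hM]; exact_mod_cast h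
    have h'' : (2 : ℝ) * 2 ^ j ≤ x := by rw [pow_succ] at hpow; linarith
    nlinarith
  have h2jM' : (2 : ℝ) ^ j * M ≤ x := by
    have := Nat.div_mul_le_self x (2 ^ j)
    rw [hM, mul_comm]; exact_mod_cast this
  have hMpos : (0 : ℝ) < M := by
    have : (0 : ℝ) < (2 : ℝ) ^ j * M := by linarith
    exact pos_of_mul_pos_right this (by positivity)
  -- `log M ≥ (log x)/2`
  have hlogM : Real.log x / 2 ≤ Real.log M := by
    have h1 : (x : ℝ) / 2 ^ (j + 1) ≤ M := by
      rw [div_le_iff₀ (by positivity), pow_succ]; linarith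
    have h2 : Real.log ((x : ℝ) / 2 ^ (j + 1)) = Real.log x - ((j : ℝ) + 1) * Real.log 2 := by
      rw [Real.log_div hx0.ne' (by positivity), Real.log_pow]; push_cast; ring
    have h3 := Real.log_le_log (by positivity) h1
    rw [h2] at h3
    linarith
  -- termwise: `2^{Ω(2^j m)} = 2^j 2^{Ω(m)} ≥ 2^j d(m)`
  have hterm : ∀ m ∈ (Icc 1 M).filter Odd, (2 : ℝ) ^ j * (m.divisors.card : ℝ) ≤ (2 : ℝ) ^ cardFactors (2 ^ j * m) := by
    intro m hm
    simp only [Finset.mem_filter, Finset.mem_Icc] at hm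
    have hm0 : m ≠ 0 := by omega
    rw [cardFactors_two_pow_mul j hm0, pow_add]
    gcongr
    exact_mod_cast card_divisors_le_two_pow_cardFactors hm0
  have hsum : (2 : ℝ) ^ j * ((M : ℝ) / 4 * Real.log M - 2 * M) ≤
      ∑ m ∈ (Icc 1 M).filter Odd, (2 : ℝ) ^ cardFactors (2 ^ j * m) := by
    calc (2 : ℝ) ^ j * ((M : ℝ) / 4 * Real.log M - 2 * M)
        ≤ (2 : ℝ) ^ j * ∑ m ∈ (Icc 1 M).filter Odd, (m.divisors.card : ℝ) :=
          mul_le_mul_of_nonneg_left (sum_odd_card_divisors_ge M) (by positivity)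
      _ = ∑ m ∈ (Icc 1 M).filter Odd, (2 : ℝ) ^ j * (m.divisors.card : ℝ) := Finset.mul_sum _ _ _
      _ ≤ _ := Finset.sum_le_sum hterm
  -- arithmetic
  have hA : (x : ℝ) * Real.log x / 16 ≤ (2 : ℝ) ^ j * ((M : ℝ) / 4 * Real.log M) := by
    have : (2 : ℝ) ^ j * ((M : ℝ) / 4 * Real.log M) = ((2 : ℝ) ^ j * M) / 4 * Real.log M := by ring
    rw [this]
    have hlx0 : 0 ≤ Real.log x / 2 := by linarith
    calc (x : ℝ) * Real.log x / 16 = (x / 2) / 4 * (Real.log x / 2) := by ring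
      _ ≤ ((2 : ℝ) ^ j * M) / 4 * Real.log M := by gcongr
  have hB : -(2 * (x : ℝ)) ≤ -((2 : ℝ) ^ j * (2 * M)) := by linarith
  calc (x : ℝ) * Real.log x / 16 - 2 * x ≤ (2 : ℝ) ^ j * ((M : ℝ) / 4 * Real.log M - 2 * M) := by linarith
    _ ≤ _ := hsum

/-- `Σ_{n ≤ x} 2^{Ω(n)} ≥ (J+1) (x (log x)/16 - 2x)` whenever `(J+1) log 2 ≤ (log x)/2`, `x ≥ 3`. [folklore] -/
theorem sum_two_pow_cardFactors_ge {x J : ℕ} (hx : 3 ≤ x) (hJ : ((J : ℝ) + 1) * Real.log 2 ≤ Real.log x / 2) :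
    ((J : ℝ) + 1) * ((x : ℝ) * Real.log x / 16 - 2 * x) ≤ ∑ n ∈ Icc 1 x, (2 : ℝ) ^ cardFactors n := by
  refine le_trans ?_ (sum_Icc_ge_sum_dyadic (fun n => (2 : ℝ) ^ cardFactors n) (fun _ => by positivity) x J)
  have h : ∀ j ∈ Finset.range (J + 1), (x : ℝ) * Real.log x / 16 - 2 * x ≤
      ∑ m ∈ (Icc 1 (x / 2 ^ j)).filter Odd, (2 : ℝ) ^ cardFactors (2 ^ j * m) := by
    intro j hj
    rw [Finset.mem_range] at hj
    refine dyadic_piece_ge hx (le_trans ?_ hJ)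
    have : (j : ℝ) + 1 ≤ (J : ℝ) + 1 := by exact_mod_cast (show j + 1 ≤ J + 1 by omega)
    exact mul_le_mul_of_nonneg_right this (Real.log_pos one_lt_two).le
  calc ((J : ℝ) + 1) * ((x : ℝ) * Real.log x / 16 - 2 * x)
      = ∑ _j ∈ Finset.range (J + 1), ((x : ℝ) * Real.log x / 16 - 2 * x) := by
        rw [Finset.sum_const, Finset.card_range, nsmul_eq_mul]; push_cast; ring
    _ ≤ _ := Finset.sum_le_sum h

/-! ### Step 6: the normalised sum of `![X]` at `y = 2` tends to `+∞` -/

/-- `Ω_{![X]}(n) = Ω(n)`. [folklore] -/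
theorem cardFactorsStat_X (n : ℕ) :
    (∑ i, cardFactors ((((![X] : Fin 1 → ℤ[X]) i).eval (n : ℤ)).toNat)) = cardFactors n := by
  simp

/-- AT `y = 2` THE Ω-NORMALISED SUM OF `f = X` DIVERGES: `x⁻¹ (log x)^{-1} Σ_{n ≤ x} 2^{Ω(n)} → +∞` (indeed it is
`≍ log x`: Grosswald; here `≥ (J+1)/32` as soon as `2^{J+1} ≤ √x` and `log x ≥ 64`). [folklore] -/
theorem tendsto_omegaNormSum_X_two_atTop :
    Tendsto (fun x : ℕ => (x : ℝ)⁻¹ * Real.exp ((1 : ℕ) * (1 - (2 : ℝ)) * Real.log (Real.log x)) *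
      ∑ n ∈ Finset.range (x + 1), (2 : ℝ) ^ (∑ i, cardFactors ((((![X] : Fin 1 → ℤ[X]) i).eval (n : ℤ)).toNat)))
      atTop atTop := by
  simp only [cardFactorsStat_X]
  refine Filter.tendsto_atTop.2 fun B => ?_
  set J : ℕ := ⌈32 * max B 0⌉₊ with hJ
  have hlog := Real.tendsto_log_atTop.comp tendsto_natCast_atTop_atTop
  filter_upwards [eventually_ge_atTop 3, hlog.eventually_ge_atTop (max 64 (2 * (((J : ℝ) + 1) * Real.log 2)))]
    with x hx hlx
  simp only [Function.comp_apply, max_le_iff] at hlx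
  obtain ⟨hl64, hlJ⟩ := hlx
  have hx0 : (0 : ℝ) < x := by exact_mod_cast (show 0 < x by omega)
  have hlpos : 0 < Real.log x := by linarith
  have hexp : Real.exp ((1 : ℕ) * (1 - (2 : ℝ)) * Real.log (Real.log x)) = (Real.log x)⁻¹ := by
    rw [show ((1 : ℕ) : ℝ) * (1 - 2) * Real.log (Real.log x) = -Real.log (Real.log x) by push_cast; ring,
      Real.exp_neg, Real.exp_log hlpos]
  rw [hexp]
  have hrange : ∑ n ∈ Icc 1 x, (2 : ℝ) ^ cardFactors n ≤ ∑ n ∈ Finset.range (x + 1), (2 : ℝ) ^ cardFactors n :=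
    Finset.sum_le_sum_of_subset_of_nonneg (fun n hn => by
      simp only [Finset.mem_Icc, Finset.mem_range] at hn ⊢; omega) fun _ _ _ => by positivity
  have hS := (sum_two_pow_cardFactors_ge (J := J) hx (by linarith)).trans hrange
  have hJB : B ≤ ((J : ℝ) + 1) / 32 := by
    have h1 : 32 * max B 0 ≤ J := Nat.le_ceil _
    have h2 : B ≤ max B 0 := le_max_left _ _
    linarith
  have hxl : 0 < (x : ℝ) * Real.log x := by positivity
  have hkey : ((J : ℝ) + 1) / 32 * ((x : ℝ) * Real.log x) ≤ ∑ n ∈ Finset.range (x + 1), (2 : ℝ) ^ cardFactors n := by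
    refine le_trans ?_ hS
    have hJ0 : (0 : ℝ) ≤ (J : ℝ) + 1 := by positivity
    have h64 : (x : ℝ) * 64 ≤ (x : ℝ) * Real.log x := mul_le_mul_of_nonneg_left hl64 hx0.le
    have h32 : (x : ℝ) * Real.log x / 32 ≤ (x : ℝ) * Real.log x / 16 - 2 * x := by linarith
    calc ((J : ℝ) + 1) / 32 * ((x : ℝ) * Real.log x) = ((J : ℝ) + 1) * ((x : ℝ) * Real.log x / 32) := by ring
      _ ≤ ((J : ℝ) + 1) * ((x : ℝ) * Real.log x / 16 - 2 * x) := mul_le_mul_of_nonneg_left h32 hJ0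
  have heq : (x : ℝ)⁻¹ * (Real.log x)⁻¹ * ∑ n ∈ Finset.range (x + 1), (2 : ℝ) ^ cardFactors n =
      (∑ n ∈ Finset.range (x + 1), (2 : ℝ) ^ cardFactors n) / ((x : ℝ) * Real.log x) := by
    rw [← mul_inv, inv_mul_eq_div]
  rw [heq]
  exact hJB.trans ((le_div_iff₀ hxl).2 hkey)

/-- Hence the Ω-law of the crux has NO limit at `y = 2` for `f = X`, whatever value is proposed. [folklore] -/
theorem not_tendsto_omegaNormSum_X_two (L : ℂ) :
    ¬Tendsto (fun x : ℕ => (x : ℂ)⁻¹ * Complex.exp (((1 : ℕ) : ℂ) * (1 - ((2 : ℝ) : ℂ)) *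
        (Real.log (Real.log x) : ℂ)) * ∑ n ∈ Finset.range (x + 1), ((2 : ℝ) : ℂ) ^ (∑ i, cardFactors ((((![X] :
          Fin 1 → ℤ[X]) i).eval (n : ℤ)).toNat))) atTop (𝓝 L) := by
  have hofReal : ∀ x : ℕ, (x : ℂ)⁻¹ * Complex.exp (((1 : ℕ) : ℂ) * (1 - ((2 : ℝ) : ℂ)) *
      (Real.log (Real.log x) : ℂ)) * ∑ n ∈ Finset.range (x + 1), ((2 : ℝ) : ℂ) ^ (∑ i, cardFactors ((((![X] :
        Fin 1 → ℤ[X]) i).eval (n : ℤ)).toNat)) =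
      (((x : ℝ)⁻¹ * Real.exp ((1 : ℕ) * (1 - (2 : ℝ)) * Real.log (Real.log x)) *
        ∑ n ∈ Finset.range (x + 1), (2 : ℝ) ^ (∑ i, cardFactors ((((![X] : Fin 1
            → ℤ[X]) i).eval (n : ℤ)).toNat)) : ℝ) : ℂ) := fun x => by
    push_cast
    rfl
  intro h
  exact not_tendsto_ofReal_of_tendsto_atTop tendsto_omegaNormSum_X_two_atTop L (h.congr hofReal)

/-- THE CLOSED SEGMENT FAILS AT ITS ENDPOINT: the crux with `y < 7/4` replaced by `y ≤ 2` (ball `|z| < 2` and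
`Λ 0 = C(f)` unchanged) is FALSE — witness the Bateman–Horn system `![X]` at `y = 2` exactly, where
`x⁻¹ (log x)^{-1} Σ_{n≤x} 2^{Ω(n)} ≍ log x → ∞` (the pole of the `p = 2` Euler factor `(1 - z/2)^{-1}` of
`Λ_X(z) = ∏_p (1 - z/p)^{-1}(1 - 1/p)^z`). Together with `not_lsdRealSegment_wide` (every `b > 2`): the real-segment
law for the un-capped `Ω` lives exactly on `y < 2`. [folklore] -/
theorem not_lsdRealSegment_upto_two :
    ¬ ∀ (k : ℕ) (f : Fin k → ℤ[X]), IsBatemanHornSystem f → ∃ Λ : ℂ → ℂ, DifferentiableOn ℂ Λ (Metric.ball 0 2) ∧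
      Λ 0 = (batemanHornConst f : ℂ) ∧ ∀ y : ℝ, 5 / 4 < y → y ≤ 2 →
        Filter.Tendsto (fun x : ℕ => (x : ℂ)⁻¹
            * Complex.exp ((k : ℂ) * (1 - (y : ℂ)) * (Real.log (Real.log x) : ℂ)) *
          ∑ n ∈ Finset.range (x + 1), (y : ℂ) ^ (∑ i, cardFactors (((f i).eval (n : ℤ)).toNat))) Filter.atTop
          (nhds (Λ y * Complex.exp (((y : ℂ) - 1) * (Real.log (∏ i, ((f i).natDegree : ℝ)) : ℂ)) *
            (Complex.Gamma y)⁻¹ ^ k)) := by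
  intro h
  obtain ⟨Λ, _, _, hlaw⟩ := h 1 ![X] isBatemanHornSystem_X
  exact not_tendsto_omegaNormSum_X_two _ (hlaw 2 (by norm_num) le_rfl)

end Summit.Parity.BatemanHorn.Theorems.LSDRealSegment.Negative
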